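import Summits.HodgeConjecture.HodgeConjecture.Theorems.WeilTypeLadderCyclicPrymHodgeRing
import Literature.AlgebraicGeometry.HodgeTheory.WeilClassesFieldRationalSpan
import Literature.AlgebraicGeometry.Deligne1982.WeilTypeCMHodgeGroupLeSU
import HarnessLib

/-!
# Weil-type ladder — the divisor–Weil shells with the DESCENT binder DISCHARGED and the Hodge-type binder read on `H¹`

Companion of `WeilTypeLadderCyclicPrymHodgeRing` (THEOREM HG (e), the five `C₃` rows `p = 13, 19, 31, 37, 43`) and
`WeilTypeLadderCyclicPrymHodgeRingHigher` (THEOREM HG′ (e), the rows `(29, C₇)`, `(31, C₅)`, `(37, C₉)`, `(41, C₅)`,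
`(43, C₇)`). Those ten shells conclude `HodgeConjectureFor B.dim B.X` for the `ζ_p`-primitive Jacobian part `B` of a
`K′`-Weil `ℤ/p`-cover family from: the placement binders, the transfer datum `hdatum` (PROPOSITION CYC′), a DESCENT
input `hQ : W ⊗ ℂ ≤ span_ℂ {rational classes of W ⊗ ℂ}`, a HODGE-TYPE input `hH : every class of W ⊗ ℂ is of type (k,k)`,
and `hgen` (the Hodge ring of the very general member is generated by divisor classes and `W ⊗ ℂ`).

THIS file removes `hQ` and replaces `hH` by the condition print states — both by LITERATURE theorems already in the
tree, so that the ladder's import invariant holds (`WeilTypeLadder*`, `Literature.*`, `HarnessLib` only):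

* §1 `hodgeConjectureFor_of_divisorWeil_descent` — the generic reduction of `…HodgeRing` §1 with `hQ` PROVED by
  Moonen–Zarhin §1 Lemma (1) on the carriers, `HodgeTheory.weilClassesField_le_span_isRationalClass`
  (`Literature/…/WeilClassesFieldRationalSpan`: for `P` irreducible over `ℚ` with `P(φ) = 0`, `W_F ⊗ ℂ` is the complex
  span of its rational classes — Galois descent by a rational operator whose kernel is `W_F ⊗ ℂ`);
  `hodgeConjectureFor_of_divisorWeil_eigenMultiplicity` — moreover `hH` REPLACED by the Weil-type multiplicity
  condition `n_ρ = n_ρ̄` for `φ^*` on `H^{1,0}` at every root of `P` (Deligne LNM 900 Prop. 4.4 ⟺, Moonen–Zarhin's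
  Criterion; tree theorem `Deligne1982.forall_isOfHodgeType_of_mem_weilClassesField_iff_forall_eigenMultiplicity_eq`,
  hypotheses `P` monic irreducible of degree `e`, `P(φ) = 0`, `e·2k = 2 dim A`).
* §2 the five `C₃` instances `hodgeConjectureFor_cyclicPrym{Thirteen_quartic, Nineteen_sextic, ThirtyOne_decic,
  ThirtySeven_duodecic, FortyThree_tetradecic}_of_eigenMultiplicity (hF₃ hP)` (the five HG′ rows are in the sibling
  `…HodgeRingHigherDescent`, split for the 400-line limit): the tree shell's binders MINUS `hQ`, with `hH`
  replaced by `hmult : ∀ ρ, P(ρ) = 0 → eigenMultiplicity B θ ρ = eigenMultiplicity B θ ρ̄`; proof = the tree shell fed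
  with the two Literature theorems and the placement file's `_irreducible` / `_monic` / `_natDegree` /
  `eval₂_…_periodDiff` lemmas (`P(θ) = 0 ⇐ Φ_p(s) = 0`), `e·(2·kn) = 2·dim B` by `omega`.

So the remaining hypotheses of every shell are exactly: the two NAMED FACTS (Shioda 1979 Thm. 2 with `s` factors,
Fulton Cor. 19.2 (b); refereed), the carrier data, the transfer datum (PROPOSITION CYC′, pen-and-paper), the `K′`-WEIL
condition on `H¹` (THEOREM W′: coset sums of the rotation numbers), and THEOREM HG (d) for the very general member
(report `HOME/b2b-hweil-pv3-g46/COMPACT-PAIRS.md`: by Rohde's Prop. 6.2.2 / Thm. 6.3.7 the monodromy argument needs NO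
'all pairs moving' hypothesis, so the shells serve the `N = 4` rows C34–C38 at `n = 1` as well). HONEST LABEL: shells
(case loci, conditional on named facts); 0 unconditional rungs above the floor; nothing of [Mar25]/[Mos26]/[Perry];
Markman-free; no `sorry`, no definition, no new named fact, no `decide`; default heartbeats.
-/

noncomputable section

set_option linter.dupNamespace false

open CategoryTheory MonoidalCategory Polynomial
open Literature.AlgebraicGeometry Literature.AlgebraicGeometry.Motives
open Literature.AlgebraicGeometry.HodgeTheory
open Literature.AlgebraicGeometry.Deligne1982
open Literature.AlgebraicGeometry.VanGeemen1994 (hodgeClassSpan)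
open Literature.AlgebraicTopology.SingularHomology

namespace Summit.HodgeConjecture.HodgeConjecture.WeilTypeLadder

/-! ### §1 The generic reduction with descent discharged -/

section Generic

/-- **`HodgeConjectureFor A` from a divisor–Weil generated Hodge ring — descent DISCHARGED.** For a complex abelian
variety `A`, `φ : A ⟶ A`, `P ∈ ℤ[T]` IRREDUCIBLE over `ℚ` with `P(φ) = 0`, `k ∈ ℕ`: if every rational `(q,q)`-class lies in
`divisorWeilAlgebra A φ P k q`, every class of `W = weilClassesField A φ P (2k)` is of type `(k,k)`, and the RATIONAL
members of `W` of type `(k,k)` are algebraic, then `HodgeConjectureFor A.dim A.X`. The descent `W ≤ span_ℂ (W ∩ Hᵏ_ℚ)`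
is Moonen–Zarhin §1 Lemma (1) on the carriers (tree theorem `weilClassesField_le_span_isRationalClass`).
[cite: MoonenZarhin1998WeilClasses, §1 (definition of W_F, Lemma (1))] [cite: Deligne1982HodgeCycles, §4 (4.4)] -/
theorem hodgeConjectureFor_of_divisorWeil_descent (A : AbelianVariety ℂ) (φ : A ⟶ A) (P : Polynomial ℤ) (k : ℕ)
    (hPirr : Irreducible (P.map (Int.castRingHom ℚ)))
    (hφ : Polynomial.eval₂ (Int.castRingHom (CategoryTheory.End A)) (φ : CategoryTheory.End A) P = 0)
    (hgen : ∀ q : ℕ, hodgeClassSpan A.dim A.X q ≤ divisorWeilAlgebra A φ P k q)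
    (hH : ∀ c ∈ weilClassesField A φ P (2 * k), IsOfHodgeType A.dim A.X (2 * k) k k c)
    (hR : ∀ c ∈ weilClassesField A φ P (2 * k), IsRationalClass c →
      IsOfHodgeType A.dim A.X (2 * k) k k c → c ∈ algebraicClasses A.X k) :
    HodgeConjectureFor A.dim A.X :=
  hodgeConjectureFor_of_divisorWeil_rational A φ P k hgen
    (weilClassesField_le_span_isRationalClass hPirr hφ (2 * k)) hH hR

/-- **The same with the Hodge-type input read on `H¹`** (Deligne's Prop. 4.4 / Moonen–Zarhin's Criterion as an
equivalence, tree theorem `forall_isOfHodgeType_of_mem_weilClassesField_iff_forall_eigenMultiplicity_eq`): for `P` monic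
irreducible of degree `e`, `P(φ) = 0`, `e·(2k) = 2·dim A`, if `n_ρ = n_ρ̄` (`eigenMultiplicity A φ`) at every complex root
`ρ` of `P`, every rational `(q,q)`-class lies in the divisor–Weil algebra, and the rational `(k,k)` members of `W` are
algebraic, then `HodgeConjectureFor A.dim A.X`. [cite: Deligne1982HodgeCycles, §4 Prop. 4.4]
[cite: MoonenZarhin1998WeilClasses, §1 (Criterion, Lemma (1))] -/
theorem hodgeConjectureFor_of_divisorWeil_eigenMultiplicity (A : AbelianVariety ℂ) (φ : A ⟶ A) (P : Polynomial ℤ)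
    (e k : ℕ) (hPm : P.Monic) (hPe : P.natDegree = e) (hPirr : Irreducible (P.map (Int.castRingHom ℚ)))
    (hφ : Polynomial.eval₂ (Int.castRingHom (CategoryTheory.End A)) (φ : CategoryTheory.End A) P = 0)
    (her : e * (2 * k) = 2 * A.dim)
    (hmult : ∀ ρ : ℂ, Polynomial.eval₂ (Int.castRingHom ℂ) ρ P = 0 →
      eigenMultiplicity A φ ρ = eigenMultiplicity A φ (starRingEnd ℂ ρ))
    (hgen : ∀ q : ℕ, hodgeClassSpan A.dim A.X q ≤ divisorWeilAlgebra A φ P k q)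
    (hR : ∀ c ∈ weilClassesField A φ P (2 * k), IsRationalClass c →
      IsOfHodgeType A.dim A.X (2 * k) k k c → c ∈ algebraicClasses A.X k) :
    HodgeConjectureFor A.dim A.X :=
  hodgeConjectureFor_of_divisorWeil_descent A φ P k hPirr hφ hgen
    ((forall_isOfHodgeType_of_mem_weilClassesField_iff_forall_eigenMultiplicity_eq hPm hPe hPirr hφ her).2 hmult) hR

end Generic

/-! ### §2 The five `C₃` rows: descent discharged, `K′`-Weil condition on `H¹` -/

section Instances

/-- **(13, C₃), quartic `K′ = ℚ(ζ₁₃)^{C₃}`, 12n-folds (C27 at n = 2): the shell with DESCENT DISCHARGED and the Weil-type condition read on `H¹`.** Binders: those of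
`weilClassesCMField_cyclicPrymThirteen_quartic_of_facts` (`B`, `s`, `n`, `Φ(s) = 0`, `dim B = 12n`, the Fermat datum, `T`, `a`, `b`)
+ `hdatum` (PROPOSITION CYC′ for every class of `W_{K′} ⊗ ℂ = weilClassesField B θ P (6n)`) + `hmult` (Moonen–Zarhin: `n_ρ = n_ρ̄`
for `θ^*` on `H^{1,0}(B)` at every complex root `ρ` of `P = X ^ 4 + 13 * X ^ 2 + 13` — the `K′`-WEIL condition, THEOREM W′)
+ `hgen` (THEOREM HG/HG′/HG″ (d): the Hodge ring of the VERY GENERAL member lies in the divisor–Weil algebra) ⊢ `HodgeConjectureFor B.dim B.X`.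
The descent input `hQ` of the tree shell is PROVED (`P` irreducible over `ℚ` — Eisenstein —, `P(θ) = 0` from `Φ(s) = 0`), the
Hodge-type input `hH` is DERIVED from `hmult` (`4·(2·3n) = 2·dim B` by `omega`). [cite: MoonenZarhin1998WeilClasses, §1 (Criterion, Lemma (1))]
[cite: Deligne1982HodgeCycles, §4 Prop. 4.4] [cite: Shioda1979PJA, §2 Thm. 2 (p. 112)] [cite: Fulton1998, §19.2 Cor. 19.2 (b)]
[cite: Rohde2009CyclicCoverings, Thm. 6.1.1, Prop. 6.2.2 and Thm. 6.3.7] -/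
theorem hodgeConjectureFor_cyclicPrymThirteen_quartic_of_eigenMultiplicity
    (hF₃ : hodgeClasses_algebraic_fermatProduct₃) (hP : fulton1998_map_mem_algebraicClasses) :
    ∀ (B : Motives.AbelianVariety ℂ) (s : B ⟶ B) (n : ℕ),
      Polynomial.eval₂ (Int.castRingHom (CategoryTheory.End B)) (s : CategoryTheory.End B)
        (Polynomial.cyclotomic 13 ℤ) = 0 → B.dim = 12 * n →
    ∀ (X₁ X₂ X₃ T : Motives.SchemeOver ℂ),
      IsFermatVariety (2 * n) 13 X₁ → IsSmoothProjective (2 * n) X₁ → IsFermatVariety (2 * n) 13 X₂ →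
      IsSmoothProjective (2 * n) X₂ → IsFermatVariety (2 * n) 13 X₃ → IsSmoothProjective (2 * n) X₃ →
      IsSmoothProjective B.dim T →
    ∀ (a : T ⟶ B.X), AlgebraicGeometry.Surjective a.left → ∀ (ι : Type) (b : ι → (T ⟶ (X₁ ⊗ X₂) ⊗ X₃)),
      (∀ c ∈ weilClassesField B
          (CategoryTheory.End.asHom (CategoryTheory.End.of s + CategoryTheory.End.of s ^ 3 + CategoryTheory.End.of s ^ 9 -
            CategoryTheory.End.of s ^ 4 - CategoryTheory.End.of s ^ 10 - CategoryTheory.End.of s ^ 12))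
          (X ^ 4 + 13 * X ^ 2 + 13 : Polynomial ℤ) (2 * (3 * n)),
        complexBetti.map a (2 * (3 * n)) c ∈ (⨆ i, (Submodule.span ℂ
            {x : complexBetti ((X₁ ⊗ X₂) ⊗ X₃) (2 * (3 * n)) |
              IsRationalClass x ∧ IsOfHodgeType (2 * n + 2 * n + 2 * n) ((X₁ ⊗ X₂) ⊗ X₃) (2 * (3 * n)) (3 * n) (3 * n) x}).map
              (complexBetti.map (b i) (2 * (3 * n))).hom)) →
      (∀ ρ : ℂ, Polynomial.eval₂ (Int.castRingHom ℂ) ρ (X ^ 4 + 13 * X ^ 2 + 13 : Polynomial ℤ) = 0 →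
        eigenMultiplicity B (CategoryTheory.End.asHom (CategoryTheory.End.of s + CategoryTheory.End.of s ^ 3 + CategoryTheory.End.of s ^ 9 -
            CategoryTheory.End.of s ^ 4 - CategoryTheory.End.of s ^ 10 - CategoryTheory.End.of s ^ 12)) ρ =
          eigenMultiplicity B (CategoryTheory.End.asHom (CategoryTheory.End.of s + CategoryTheory.End.of s ^ 3 + CategoryTheory.End.of s ^ 9 -
            CategoryTheory.End.of s ^ 4 - CategoryTheory.End.of s ^ 10 - CategoryTheory.End.of s ^ 12)) (starRingEnd ℂ ρ)) →
      (∀ q : ℕ, hodgeClassSpan B.dim B.X q ≤ divisorWeilAlgebra B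
          (CategoryTheory.End.asHom (CategoryTheory.End.of s + CategoryTheory.End.of s ^ 3 + CategoryTheory.End.of s ^ 9 -
            CategoryTheory.End.of s ^ 4 - CategoryTheory.End.of s ^ 10 - CategoryTheory.End.of s ^ 12))
          (X ^ 4 + 13 * X ^ 2 + 13 : Polynomial ℤ) (3 * n) q) →
      HodgeConjectureFor B.dim B.X := by
  intro B s n hs hdim X₁ X₂ X₃ T hF₁' hX₁ hF₂' hX₂ hF₃' hX₃ hT a ha ι b hdatum hmult hgen
  have hφ : Polynomial.eval₂ (Int.castRingHom (CategoryTheory.End B))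
      ((CategoryTheory.End.asHom (CategoryTheory.End.of s + CategoryTheory.End.of s ^ 3 + CategoryTheory.End.of s ^ 9 -
            CategoryTheory.End.of s ^ 4 - CategoryTheory.End.of s ^ 10 - CategoryTheory.End.of s ^ 12) : B ⟶ B) :
        CategoryTheory.End B) (X ^ 4 + 13 * X ^ 2 + 13 : Polynomial ℤ) = 0 :=
    eval₂_quarticThirteen_periodDiff (CategoryTheory.End.of s) hs
  exact hodgeConjectureFor_cyclicPrymThirteen_quartic_of_facts hF₃ hP B s n hs hdim X₁ X₂ X₃ T hF₁' hX₁ hF₂' hX₂ hF₃' hX₃ hT a ha ι b hdatum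
    (weilClassesField_le_span_isRationalClass quarticThirteen_irreducible hφ (2 * (3 * n)))
    ((forall_isOfHodgeType_of_mem_weilClassesField_iff_forall_eigenMultiplicity_eq (p := 3 * n)
      quarticThirteen_monic quarticThirteen_natDegree quarticThirteen_irreducible hφ (by omega)).2 hmult)
    hgen

/-- **(19, C₃), sextic `K′ = ℚ(ζ₁₉)^{C₃}`, 18n-folds (C28 at n = 2): the shell with DESCENT DISCHARGED and the Weil-type condition read on `H¹`.** Binders: those of
`weilClassesCMField_cyclicPrymNineteen_sextic_of_facts` (`B`, `s`, `n`, `Φ(s) = 0`, `dim B = 18n`, the Fermat datum, `T`, `a`, `b`)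
+ `hdatum` (PROPOSITION CYC′ for every class of `W_{K′} ⊗ ℂ = weilClassesField B θ P (6n)`) + `hmult` (Moonen–Zarhin: `n_ρ = n_ρ̄`
for `θ^*` on `H^{1,0}(B)` at every complex root `ρ` of `P = X ^ 6 + 19 * X ^ 4 + 38 * X ^ 2 + 19` — the `K′`-WEIL condition, THEOREM W′)
+ `hgen` (THEOREM HG/HG′/HG″ (d): the Hodge ring of the VERY GENERAL member lies in the divisor–Weil algebra) ⊢ `HodgeConjectureFor B.dim B.X`.
The descent input `hQ` of the tree shell is PROVED (`P` irreducible over `ℚ` — Eisenstein —, `P(θ) = 0` from `Φ(s) = 0`), the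
Hodge-type input `hH` is DERIVED from `hmult` (`6·(2·3n) = 2·dim B` by `omega`). [cite: MoonenZarhin1998WeilClasses, §1 (Criterion, Lemma (1))]
[cite: Deligne1982HodgeCycles, §4 Prop. 4.4] [cite: Shioda1979PJA, §2 Thm. 2 (p. 112)] [cite: Fulton1998, §19.2 Cor. 19.2 (b)]
[cite: Rohde2009CyclicCoverings, Thm. 6.1.1, Prop. 6.2.2 and Thm. 6.3.7] -/
theorem hodgeConjectureFor_cyclicPrymNineteen_sextic_of_eigenMultiplicity
    (hF₃ : hodgeClasses_algebraic_fermatProduct₃) (hP : fulton1998_map_mem_algebraicClasses) :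
    ∀ (B : Motives.AbelianVariety ℂ) (s : B ⟶ B) (n : ℕ),
      Polynomial.eval₂ (Int.castRingHom (CategoryTheory.End B)) (s : CategoryTheory.End B)
        (Polynomial.cyclotomic 19 ℤ) = 0 → B.dim = 18 * n →
    ∀ (X₁ X₂ X₃ T : Motives.SchemeOver ℂ),
      IsFermatVariety (2 * n) 19 X₁ → IsSmoothProjective (2 * n) X₁ → IsFermatVariety (2 * n) 19 X₂ →
      IsSmoothProjective (2 * n) X₂ → IsFermatVariety (2 * n) 19 X₃ → IsSmoothProjective (2 * n) X₃ →
      IsSmoothProjective B.dim T →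
    ∀ (a : T ⟶ B.X), AlgebraicGeometry.Surjective a.left → ∀ (ι : Type) (b : ι → (T ⟶ (X₁ ⊗ X₂) ⊗ X₃)),
      (∀ c ∈ weilClassesField B
          (CategoryTheory.End.asHom (CategoryTheory.End.of s + CategoryTheory.End.of s ^ 7 + CategoryTheory.End.of s ^ 11 -
            CategoryTheory.End.of s ^ 8 - CategoryTheory.End.of s ^ 12 - CategoryTheory.End.of s ^ 18))
          (X ^ 6 + 19 * X ^ 4 + 38 * X ^ 2 + 19 : Polynomial ℤ) (2 * (3 * n)),
        complexBetti.map a (2 * (3 * n)) c ∈ (⨆ i, (Submodule.span ℂ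
            {x : complexBetti ((X₁ ⊗ X₂) ⊗ X₃) (2 * (3 * n)) |
              IsRationalClass x ∧ IsOfHodgeType (2 * n + 2 * n + 2 * n) ((X₁ ⊗ X₂) ⊗ X₃) (2 * (3 * n)) (3 * n) (3 * n) x}).map
              (complexBetti.map (b i) (2 * (3 * n))).hom)) →
      (∀ ρ : ℂ, Polynomial.eval₂ (Int.castRingHom ℂ) ρ (X ^ 6 + 19 * X ^ 4 + 38 * X ^ 2 + 19 : Polynomial ℤ) = 0 →
        eigenMultiplicity B (CategoryTheory.End.asHom (CategoryTheory.End.of s + CategoryTheory.End.of s ^ 7 + CategoryTheory.End.of s ^ 11 -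
            CategoryTheory.End.of s ^ 8 - CategoryTheory.End.of s ^ 12 - CategoryTheory.End.of s ^ 18)) ρ =
          eigenMultiplicity B (CategoryTheory.End.asHom (CategoryTheory.End.of s + CategoryTheory.End.of s ^ 7 + CategoryTheory.End.of s ^ 11 -
            CategoryTheory.End.of s ^ 8 - CategoryTheory.End.of s ^ 12 - CategoryTheory.End.of s ^ 18)) (starRingEnd ℂ ρ)) →
      (∀ q : ℕ, hodgeClassSpan B.dim B.X q ≤ divisorWeilAlgebra B
          (CategoryTheory.End.asHom (CategoryTheory.End.of s + CategoryTheory.End.of s ^ 7 + CategoryTheory.End.of s ^ 11 -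
            CategoryTheory.End.of s ^ 8 - CategoryTheory.End.of s ^ 12 - CategoryTheory.End.of s ^ 18))
          (X ^ 6 + 19 * X ^ 4 + 38 * X ^ 2 + 19 : Polynomial ℤ) (3 * n) q) →
      HodgeConjectureFor B.dim B.X := by
  intro B s n hs hdim X₁ X₂ X₃ T hF₁' hX₁ hF₂' hX₂ hF₃' hX₃ hT a ha ι b hdatum hmult hgen
  have hφ : Polynomial.eval₂ (Int.castRingHom (CategoryTheory.End B))
      ((CategoryTheory.End.asHom (CategoryTheory.End.of s + CategoryTheory.End.of s ^ 7 + CategoryTheory.End.of s ^ 11 -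
            CategoryTheory.End.of s ^ 8 - CategoryTheory.End.of s ^ 12 - CategoryTheory.End.of s ^ 18) : B ⟶ B) :
        CategoryTheory.End B) (X ^ 6 + 19 * X ^ 4 + 38 * X ^ 2 + 19 : Polynomial ℤ) = 0 :=
    eval₂_sexticNineteen_periodDiff (CategoryTheory.End.of s) hs
  exact hodgeConjectureFor_cyclicPrymNineteen_sextic_of_facts hF₃ hP B s n hs hdim X₁ X₂ X₃ T hF₁' hX₁ hF₂' hX₂ hF₃' hX₃ hT a ha ι b hdatum
    (weilClassesField_le_span_isRationalClass sexticNineteen_irreducible hφ (2 * (3 * n)))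
    ((forall_isOfHodgeType_of_mem_weilClassesField_iff_forall_eigenMultiplicity_eq (p := 3 * n)
      sexticNineteen_monic sexticNineteen_natDegree sexticNineteen_irreducible hφ (by omega)).2 hmult)
    hgen

/-- **(31, C₃), decic `K′ = ℚ(ζ₃₁)^{C₃}`, 30n-folds (C31 at n = 2): the shell with DESCENT DISCHARGED and the Weil-type condition read on `H¹`.** Binders: those of
`weilClassesCMField_cyclicPrymThirtyOne_decic_of_facts` (`B`, `s`, `n`, `Φ(s) = 0`, `dim B = 30n`, the Fermat datum, `T`, `a`, `b`)
+ `hdatum` (PROPOSITION CYC′ for every class of `W_{K′} ⊗ ℂ = weilClassesField B θ P (6n)`) + `hmult` (Moonen–Zarhin: `n_ρ = n_ρ̄`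
for `θ^*` on `H^{1,0}(B)` at every complex root `ρ` of `P = X ^ 10 + 31 * X ^ 8 + 248 * X ^ 6 + 713 * X ^ 4 + 651 * X ^ 2 + 31` — the `K′`-WEIL condition, THEOREM W′)
+ `hgen` (THEOREM HG/HG′/HG″ (d): the Hodge ring of the VERY GENERAL member lies in the divisor–Weil algebra) ⊢ `HodgeConjectureFor B.dim B.X`.
The descent input `hQ` of the tree shell is PROVED (`P` irreducible over `ℚ` — Eisenstein —, `P(θ) = 0` from `Φ(s) = 0`), the
Hodge-type input `hH` is DERIVED from `hmult` (`10·(2·3n) = 2·dim B` by `omega`). [cite: MoonenZarhin1998WeilClasses, §1 (Criterion, Lemma (1))]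
[cite: Deligne1982HodgeCycles, §4 Prop. 4.4] [cite: Shioda1979PJA, §2 Thm. 2 (p. 112)] [cite: Fulton1998, §19.2 Cor. 19.2 (b)]
[cite: Rohde2009CyclicCoverings, Thm. 6.1.1, Prop. 6.2.2 and Thm. 6.3.7] -/
theorem hodgeConjectureFor_cyclicPrymThirtyOne_decic_of_eigenMultiplicity
    (hF₃ : hodgeClasses_algebraic_fermatProduct₃) (hP : fulton1998_map_mem_algebraicClasses) :
    ∀ (B : Motives.AbelianVariety ℂ) (s : B ⟶ B) (n : ℕ),
      Polynomial.eval₂ (Int.castRingHom (CategoryTheory.End B)) (s : CategoryTheory.End B)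
        (Polynomial.cyclotomic 31 ℤ) = 0 → B.dim = 30 * n →
    ∀ (X₁ X₂ X₃ T : Motives.SchemeOver ℂ),
      IsFermatVariety (2 * n) 31 X₁ → IsSmoothProjective (2 * n) X₁ → IsFermatVariety (2 * n) 31 X₂ →
      IsSmoothProjective (2 * n) X₂ → IsFermatVariety (2 * n) 31 X₃ → IsSmoothProjective (2 * n) X₃ →
      IsSmoothProjective B.dim T →
    ∀ (a : T ⟶ B.X), AlgebraicGeometry.Surjective a.left → ∀ (ι : Type) (b : ι → (T ⟶ (X₁ ⊗ X₂) ⊗ X₃)),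
      (∀ c ∈ weilClassesField B
          (CategoryTheory.End.asHom (CategoryTheory.End.of s + CategoryTheory.End.of s ^ 5 + CategoryTheory.End.of s ^ 25 - CategoryTheory.End.of s ^ 6 - CategoryTheory.End.of s ^ 26 - CategoryTheory.End.of s ^ 30))
          (X ^ 10 + 31 * X ^ 8 + 248 * X ^ 6 + 713 * X ^ 4 + 651 * X ^ 2 + 31 : Polynomial ℤ) (2 * (3 * n)),
        complexBetti.map a (2 * (3 * n)) c ∈ (⨆ i, (Submodule.span ℂ
            {x : complexBetti ((X₁ ⊗ X₂) ⊗ X₃) (2 * (3 * n)) |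
              IsRationalClass x ∧ IsOfHodgeType (2 * n + 2 * n + 2 * n) ((X₁ ⊗ X₂) ⊗ X₃) (2 * (3 * n)) (3 * n) (3 * n) x}).map
              (complexBetti.map (b i) (2 * (3 * n))).hom)) →
      (∀ ρ : ℂ, Polynomial.eval₂ (Int.castRingHom ℂ) ρ (X ^ 10 + 31 * X ^ 8 + 248 * X ^ 6 + 713 * X ^ 4 + 651 * X ^ 2 + 31 : Polynomial ℤ) = 0 →
        eigenMultiplicity B (CategoryTheory.End.asHom (CategoryTheory.End.of s + CategoryTheory.End.of s ^ 5 + CategoryTheory.End.of s ^ 25 - CategoryTheory.End.of s ^ 6 - CategoryTheory.End.of s ^ 26 - CategoryTheory.End.of s ^ 30)) ρ =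
          eigenMultiplicity B (CategoryTheory.End.asHom (CategoryTheory.End.of s + CategoryTheory.End.of s ^ 5 + CategoryTheory.End.of s ^ 25 - CategoryTheory.End.of s ^ 6 - CategoryTheory.End.of s ^ 26 - CategoryTheory.End.of s ^ 30)) (starRingEnd ℂ ρ)) →
      (∀ q : ℕ, hodgeClassSpan B.dim B.X q ≤ divisorWeilAlgebra B
          (CategoryTheory.End.asHom (CategoryTheory.End.of s + CategoryTheory.End.of s ^ 5 + CategoryTheory.End.of s ^ 25 - CategoryTheory.End.of s ^ 6 - CategoryTheory.End.of s ^ 26 - CategoryTheory.End.of s ^ 30))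
          (X ^ 10 + 31 * X ^ 8 + 248 * X ^ 6 + 713 * X ^ 4 + 651 * X ^ 2 + 31 : Polynomial ℤ) (3 * n) q) →
      HodgeConjectureFor B.dim B.X := by
  intro B s n hs hdim X₁ X₂ X₃ T hF₁' hX₁ hF₂' hX₂ hF₃' hX₃ hT a ha ι b hdatum hmult hgen
  have hφ : Polynomial.eval₂ (Int.castRingHom (CategoryTheory.End B))
      ((CategoryTheory.End.asHom (CategoryTheory.End.of s + CategoryTheory.End.of s ^ 5 + CategoryTheory.End.of s ^ 25 - CategoryTheory.End.of s ^ 6 - CategoryTheory.End.of s ^ 26 - CategoryTheory.End.of s ^ 30) : B ⟶ B) :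
        CategoryTheory.End B) (X ^ 10 + 31 * X ^ 8 + 248 * X ^ 6 + 713 * X ^ 4 + 651 * X ^ 2 + 31 : Polynomial ℤ) = 0 :=
    eval₂_decicThirtyOne_periodDiff (CategoryTheory.End.of s) hs
  exact hodgeConjectureFor_cyclicPrymThirtyOne_decic_of_facts hF₃ hP B s n hs hdim X₁ X₂ X₃ T hF₁' hX₁ hF₂' hX₂ hF₃' hX₃ hT a ha ι b hdatum
    (weilClassesField_le_span_isRationalClass decicThirtyOne_irreducible hφ (2 * (3 * n)))
    ((forall_isOfHodgeType_of_mem_weilClassesField_iff_forall_eigenMultiplicity_eq (p := 3 * n)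
      decicThirtyOne_monic decicThirtyOne_natDegree decicThirtyOne_irreducible hφ (by omega)).2 hmult)
    hgen

/-- **(37, C₃), duodecic `K′ = ℚ(ζ₃₇)^{C₃}`, 36n-folds (C32 at n = 2): the shell with DESCENT DISCHARGED and the Weil-type condition read on `H¹`.** Binders: those of
`weilClassesCMField_cyclicPrymThirtySeven_duodecic_of_facts` (`B`, `s`, `n`, `Φ(s) = 0`, `dim B = 36n`, the Fermat datum, `T`, `a`, `b`)
+ `hdatum` (PROPOSITION CYC′ for every class of `W_{K′} ⊗ ℂ = weilClassesField B θ P (6n)`) + `hmult` (Moonen–Zarhin: `n_ρ = n_ρ̄`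
for `θ^*` on `H^{1,0}(B)` at every complex root `ρ` of `P = X ^ 12 + 37 * X ^ 10 + 407 * X ^ 8 + 1628 * X ^ 6 + 2035 * X ^ 4 + 518 * X ^ 2 + 37` — the `K′`-WEIL condition, THEOREM W′)
+ `hgen` (THEOREM HG/HG′/HG″ (d): the Hodge ring of the VERY GENERAL member lies in the divisor–Weil algebra) ⊢ `HodgeConjectureFor B.dim B.X`.
The descent input `hQ` of the tree shell is PROVED (`P` irreducible over `ℚ` — Eisenstein —, `P(θ) = 0` from `Φ(s) = 0`), the
Hodge-type input `hH` is DERIVED from `hmult` (`12·(2·3n) = 2·dim B` by `omega`). [cite: MoonenZarhin1998WeilClasses, §1 (Criterion, Lemma (1))]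
[cite: Deligne1982HodgeCycles, §4 Prop. 4.4] [cite: Shioda1979PJA, §2 Thm. 2 (p. 112)] [cite: Fulton1998, §19.2 Cor. 19.2 (b)]
[cite: Rohde2009CyclicCoverings, Thm. 6.1.1, Prop. 6.2.2 and Thm. 6.3.7] -/
theorem hodgeConjectureFor_cyclicPrymThirtySeven_duodecic_of_eigenMultiplicity
    (hF₃ : hodgeClasses_algebraic_fermatProduct₃) (hP : fulton1998_map_mem_algebraicClasses) :
    ∀ (B : Motives.AbelianVariety ℂ) (s : B ⟶ B) (n : ℕ),
      Polynomial.eval₂ (Int.castRingHom (CategoryTheory.End B)) (s : CategoryTheory.End B)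
        (Polynomial.cyclotomic 37 ℤ) = 0 → B.dim = 36 * n →
    ∀ (X₁ X₂ X₃ T : Motives.SchemeOver ℂ),
      IsFermatVariety (2 * n) 37 X₁ → IsSmoothProjective (2 * n) X₁ → IsFermatVariety (2 * n) 37 X₂ →
      IsSmoothProjective (2 * n) X₂ → IsFermatVariety (2 * n) 37 X₃ → IsSmoothProjective (2 * n) X₃ →
      IsSmoothProjective B.dim T →
    ∀ (a : T ⟶ B.X), AlgebraicGeometry.Surjective a.left → ∀ (ι : Type) (b : ι → (T ⟶ (X₁ ⊗ X₂) ⊗ X₃)),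
      (∀ c ∈ weilClassesField B
          (CategoryTheory.End.asHom (CategoryTheory.End.of s + CategoryTheory.End.of s ^ 10 + CategoryTheory.End.of s ^ 26 - CategoryTheory.End.of s ^ 11 - CategoryTheory.End.of s ^ 27 - CategoryTheory.End.of s ^ 36))
          (X ^ 12 + 37 * X ^ 10 + 407 * X ^ 8 + 1628 * X ^ 6 + 2035 * X ^ 4 + 518 * X ^ 2 + 37 : Polynomial ℤ) (2 * (3 * n)),
        complexBetti.map a (2 * (3 * n)) c ∈ (⨆ i, (Submodule.span ℂ
            {x : complexBetti ((X₁ ⊗ X₂) ⊗ X₃) (2 * (3 * n)) |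
              IsRationalClass x ∧ IsOfHodgeType (2 * n + 2 * n + 2 * n) ((X₁ ⊗ X₂) ⊗ X₃) (2 * (3 * n)) (3 * n) (3 * n) x}).map
              (complexBetti.map (b i) (2 * (3 * n))).hom)) →
      (∀ ρ : ℂ, Polynomial.eval₂ (Int.castRingHom ℂ) ρ (X ^ 12 + 37 * X ^ 10 + 407 * X ^ 8 + 1628 * X ^ 6 + 2035 * X ^ 4 + 518 * X ^ 2 + 37 : Polynomial ℤ) = 0 →
        eigenMultiplicity B (CategoryTheory.End.asHom (CategoryTheory.End.of s + CategoryTheory.End.of s ^ 10 + CategoryTheory.End.of s ^ 26 - CategoryTheory.End.of s ^ 11 - CategoryTheory.End.of s ^ 27 - CategoryTheory.End.of s ^ 36)) ρ =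
          eigenMultiplicity B (CategoryTheory.End.asHom (CategoryTheory.End.of s + CategoryTheory.End.of s ^ 10 + CategoryTheory.End.of s ^ 26 - CategoryTheory.End.of s ^ 11 - CategoryTheory.End.of s ^ 27 - CategoryTheory.End.of s ^ 36)) (starRingEnd ℂ ρ)) →
      (∀ q : ℕ, hodgeClassSpan B.dim B.X q ≤ divisorWeilAlgebra B
          (CategoryTheory.End.asHom (CategoryTheory.End.of s + CategoryTheory.End.of s ^ 10 + CategoryTheory.End.of s ^ 26 - CategoryTheory.End.of s ^ 11 - CategoryTheory.End.of s ^ 27 - CategoryTheory.End.of s ^ 36))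
          (X ^ 12 + 37 * X ^ 10 + 407 * X ^ 8 + 1628 * X ^ 6 + 2035 * X ^ 4 + 518 * X ^ 2 + 37 : Polynomial ℤ) (3 * n) q) →
      HodgeConjectureFor B.dim B.X := by
  intro B s n hs hdim X₁ X₂ X₃ T hF₁' hX₁ hF₂' hX₂ hF₃' hX₃ hT a ha ι b hdatum hmult hgen
  have hφ : Polynomial.eval₂ (Int.castRingHom (CategoryTheory.End B))
      ((CategoryTheory.End.asHom (CategoryTheory.End.of s + CategoryTheory.End.of s ^ 10 + CategoryTheory.End.of s ^ 26 - CategoryTheory.End.of s ^ 11 - CategoryTheory.End.of s ^ 27 - CategoryTheory.End.of s ^ 36) : B ⟶ B) :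
        CategoryTheory.End B) (X ^ 12 + 37 * X ^ 10 + 407 * X ^ 8 + 1628 * X ^ 6 + 2035 * X ^ 4 + 518 * X ^ 2 + 37 : Polynomial ℤ) = 0 :=
    eval₂_duodecicThirtySeven_periodDiff (CategoryTheory.End.of s) hs
  exact hodgeConjectureFor_cyclicPrymThirtySeven_duodecic_of_facts hF₃ hP B s n hs hdim X₁ X₂ X₃ T hF₁' hX₁ hF₂' hX₂ hF₃' hX₃ hT a ha ι b hdatum
    (weilClassesField_le_span_isRationalClass duodecicThirtySeven_irreducible hφ (2 * (3 * n)))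
    ((forall_isOfHodgeType_of_mem_weilClassesField_iff_forall_eigenMultiplicity_eq (p := 3 * n)
      duodecicThirtySeven_monic duodecicThirtySeven_natDegree duodecicThirtySeven_irreducible hφ (by omega)).2 hmult)
    hgen

/-- **(43, C₃), tetradecic `K′ = ℚ(ζ₄₃)^{C₃}`, 42n-folds (C33 at n = 2): the shell with DESCENT DISCHARGED and the Weil-type condition read on `H¹`.** Binders: those of
`weilClassesCMField_cyclicPrymFortyThree_tetradecic_of_facts` (`B`, `s`, `n`, `Φ(s) = 0`, `dim B = 42n`, the Fermat datum, `T`, `a`, `b`)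
+ `hdatum` (PROPOSITION CYC′ for every class of `W_{K′} ⊗ ℂ = weilClassesField B θ P (6n)`) + `hmult` (Moonen–Zarhin: `n_ρ = n_ρ̄`
for `θ^*` on `H^{1,0}(B)` at every complex root `ρ` of `P = X ^ 14 + 43 * X ^ 12 + 602 * X ^ 10 + 3397 * X ^ 8 + 8514 * X ^ 6 + 9030 * X ^ 4 + 3053 * X ^ 2 + 43` — the `K′`-WEIL condition, THEOREM W′)
+ `hgen` (THEOREM HG/HG′/HG″ (d): the Hodge ring of the VERY GENERAL member lies in the divisor–Weil algebra) ⊢ `HodgeConjectureFor B.dim B.X`.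
The descent input `hQ` of the tree shell is PROVED (`P` irreducible over `ℚ` — Eisenstein —, `P(θ) = 0` from `Φ(s) = 0`), the
Hodge-type input `hH` is DERIVED from `hmult` (`14·(2·3n) = 2·dim B` by `omega`). [cite: MoonenZarhin1998WeilClasses, §1 (Criterion, Lemma (1))]
[cite: Deligne1982HodgeCycles, §4 Prop. 4.4] [cite: Shioda1979PJA, §2 Thm. 2 (p. 112)] [cite: Fulton1998, §19.2 Cor. 19.2 (b)]
[cite: Rohde2009CyclicCoverings, Thm. 6.1.1, Prop. 6.2.2 and Thm. 6.3.7] -/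
theorem hodgeConjectureFor_cyclicPrymFortyThree_tetradecic_of_eigenMultiplicity
    (hF₃ : hodgeClasses_algebraic_fermatProduct₃) (hP : fulton1998_map_mem_algebraicClasses) :
    ∀ (B : Motives.AbelianVariety ℂ) (s : B ⟶ B) (n : ℕ),
      Polynomial.eval₂ (Int.castRingHom (CategoryTheory.End B)) (s : CategoryTheory.End B)
        (Polynomial.cyclotomic 43 ℤ) = 0 → B.dim = 42 * n →
    ∀ (X₁ X₂ X₃ T : Motives.SchemeOver ℂ),
      IsFermatVariety (2 * n) 43 X₁ → IsSmoothProjective (2 * n) X₁ → IsFermatVariety (2 * n) 43 X₂ →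
      IsSmoothProjective (2 * n) X₂ → IsFermatVariety (2 * n) 43 X₃ → IsSmoothProjective (2 * n) X₃ →
      IsSmoothProjective B.dim T →
    ∀ (a : T ⟶ B.X), AlgebraicGeometry.Surjective a.left → ∀ (ι : Type) (b : ι → (T ⟶ (X₁ ⊗ X₂) ⊗ X₃)),
      (∀ c ∈ weilClassesField B
          (CategoryTheory.End.asHom (CategoryTheory.End.of s + CategoryTheory.End.of s ^ 6 + CategoryTheory.End.of s ^ 36 - CategoryTheory.End.of s ^ 7 - CategoryTheory.End.of s ^ 37 - CategoryTheory.End.of s ^ 42))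
          (X ^ 14 + 43 * X ^ 12 + 602 * X ^ 10 + 3397 * X ^ 8 + 8514 * X ^ 6 + 9030 * X ^ 4 + 3053 * X ^ 2 + 43 : Polynomial ℤ) (2 * (3 * n)),
        complexBetti.map a (2 * (3 * n)) c ∈ (⨆ i, (Submodule.span ℂ
            {x : complexBetti ((X₁ ⊗ X₂) ⊗ X₃) (2 * (3 * n)) |
              IsRationalClass x ∧ IsOfHodgeType (2 * n + 2 * n + 2 * n) ((X₁ ⊗ X₂) ⊗ X₃) (2 * (3 * n)) (3 * n) (3 * n) x}).map
              (complexBetti.map (b i) (2 * (3 * n))).hom)) →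
      (∀ ρ : ℂ, Polynomial.eval₂ (Int.castRingHom ℂ) ρ (X ^ 14 + 43 * X ^ 12 + 602 * X ^ 10 + 3397 * X ^ 8 + 8514 * X ^ 6 + 9030 * X ^ 4 + 3053 * X ^ 2 + 43 : Polynomial ℤ) = 0 →
        eigenMultiplicity B (CategoryTheory.End.asHom (CategoryTheory.End.of s + CategoryTheory.End.of s ^ 6 + CategoryTheory.End.of s ^ 36 - CategoryTheory.End.of s ^ 7 - CategoryTheory.End.of s ^ 37 - CategoryTheory.End.of s ^ 42)) ρ =
          eigenMultiplicity B (CategoryTheory.End.asHom (CategoryTheory.End.of s + CategoryTheory.End.of s ^ 6 + CategoryTheory.End.of s ^ 36 - CategoryTheory.End.of s ^ 7 - CategoryTheory.End.of s ^ 37 - CategoryTheory.End.of s ^ 42)) (starRingEnd ℂ ρ)) →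
      (∀ q : ℕ, hodgeClassSpan B.dim B.X q ≤ divisorWeilAlgebra B
          (CategoryTheory.End.asHom (CategoryTheory.End.of s + CategoryTheory.End.of s ^ 6 + CategoryTheory.End.of s ^ 36 - CategoryTheory.End.of s ^ 7 - CategoryTheory.End.of s ^ 37 - CategoryTheory.End.of s ^ 42))
          (X ^ 14 + 43 * X ^ 12 + 602 * X ^ 10 + 3397 * X ^ 8 + 8514 * X ^ 6 + 9030 * X ^ 4 + 3053 * X ^ 2 + 43 : Polynomial ℤ) (3 * n) q) →
      HodgeConjectureFor B.dim B.X := by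
  intro B s n hs hdim X₁ X₂ X₃ T hF₁' hX₁ hF₂' hX₂ hF₃' hX₃ hT a ha ι b hdatum hmult hgen
  have hφ : Polynomial.eval₂ (Int.castRingHom (CategoryTheory.End B))
      ((CategoryTheory.End.asHom (CategoryTheory.End.of s + CategoryTheory.End.of s ^ 6 + CategoryTheory.End.of s ^ 36 - CategoryTheory.End.of s ^ 7 - CategoryTheory.End.of s ^ 37 - CategoryTheory.End.of s ^ 42) : B ⟶ B) :
        CategoryTheory.End B) (X ^ 14 + 43 * X ^ 12 + 602 * X ^ 10 + 3397 * X ^ 8 + 8514 * X ^ 6 + 9030 * X ^ 4 + 3053 * X ^ 2 + 43 : Polynomial ℤ) = 0 :=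
    eval₂_tetradecicFortyThree_periodDiff (CategoryTheory.End.of s) hs
  exact hodgeConjectureFor_cyclicPrymFortyThree_tetradecic_of_facts hF₃ hP B s n hs hdim X₁ X₂ X₃ T hF₁' hX₁ hF₂' hX₂ hF₃' hX₃ hT a ha ι b hdatum
    (weilClassesField_le_span_isRationalClass tetradecicFortyThree_irreducible hφ (2 * (3 * n)))
    ((forall_isOfHodgeType_of_mem_weilClassesField_iff_forall_eigenMultiplicity_eq (p := 3 * n)
      tetradecicFortyThree_monic tetradecicFortyThree_natDegree tetradecicFortyThree_irreducible hφ (by omega)).2 hmult)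
    hgen

end Instances

end Summit.HodgeConjecture.HodgeConjecture.WeilTypeLadder

end
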